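import Literature.MathematicalPhysics.QuantumFieldTheory.Balaban1983to89.BlockAveragingTwoLevel
import Literature.MathematicalPhysics.QuantumFieldTheory.Balaban1983to89.AveragingReflection

/-!
# `Balaban1983to89.B12GaugeFixInvariance269` — [Balaban1987RG1] p. 269: «By their definitions the expressions in
(2.1) are invariant with respect to these transformations» — PROVED for the gauge-fixing term `G(V)` of (2.1)/(0.17)
built on the CONCRETE averaged contour variables (0.11), under the coarse translations, the centre reflections and
(on the small-field domain) the coordinate permutations of (2.17)

HONEST FRAMING (cell `lit-balaban`, verbatim): statement-level skeleton of published theorems with citation tags; proofs where landed; nothing here is a claim about the Yang–Mills mass gap.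

CITATION HEADER.  T. Bałaban, *Renormalization group approach to lattice gauge field theories. I. Generation of
effective actions in a small field approximation and a coupling constant renormalization in four dimensions*,
Commun. Math. Phys. **109** (1987) 249–301, doi:10.1007/bf01215223 [Balaban1987RG1] (cell paper B12; held text
`paper:balaban1987-cmp109-rg-i-small-field`, journal page = PDF page + 248; p. 269 read from the page render
`b2b-balaban-ref1/pages/1987-cmp109-rg-I-small-field/…-p021-x2.png`, (2.1) from `…-p017-x2.png` (p. 265), (0.17) and
the gauge-fixing term from `…-p007-x2.png` (p. 255)).  Unit `lit-balaban-r09` gen 2 (Phase 2), SKELETON rows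
`B12.Eq2.17-2.18` (companion of `B12EuclTransf218`) and `B12.Txt@263b` (Euclidean invariance of the actions; carrier
`B12SmallFieldDomain259.EuclInvariant`).  Pre-existing carriers (named, not re-declared): the gauge-fixing function
`Setup.gaugeFixFn cd Y U = Σ_{y∈Y} Σ_{x∈B(y), x≠y} [1 − Re tr U(y,x)]` ((0.17) p. 255 / (2.1) p. 265), the concrete
contour variables `BlockAveragingTwoLevel.contourData 𝓜` ((0.11)) with their transport lemmas
`BlockAveragingTwoLevel.cVar_translate` / `cVar_permute` / `stairHol_translate` / `stairHol_permute_eq` /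
`adm_permute_iff`, the coarse-to-fine translation vector `Site.scale` with `Site.emb_add` (`T4Covariance`), and the
symmetry maps `GaugeField.translate` / `GaugeField.permute` ((2.17); `B12EuclTransf218.eq217_*`).

WHAT IS PRINTED (verbatim, p. 269).  *«Now consider a Euclidean symmetry r of the torus T, preserving the torus
T^{(k+1)}. We define generally (rU)(b) = U(rb), rb = r⟨b₋, b₊⟩ = ⟨rb₋, rb₊⟩. (2.17)  By their definitions the
expressions in (2.1) are invariant with respect to these transformations.»*  ((2.1) p. 265:
`(T_kA_k)(W) = log N_k⁻¹ ∫dV δ(V̄W⁻¹) χ_k exp[−(1/g_k²)G(V) − (1/g_k²)A(U_k(V)) + E_k(U_k(V))]`, where `G` is the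
gauge-fixing term of (0.17): `Σ_{y∈T^{(k+1)}} Σ_{x∈B(y), x≠y} [1 − Re tr V(y,x)]`.)

WHAT THIS MODULE PROVES (kernel-checked finite reindexing; no `Prop` fact).
* Geometry of the nested tori under a coarse translation `a ∈ T^{(k+1)}` acting on `T^{(k)}` by the fine vector `L·a`
  (`Site.scale a`): `offsetOf_add_scale` (offsets from the block centre are translation invariant), `blockSite_add`,
  `blockOf_add_scale` (**blocks go to blocks: `B^k(x + L·a) = B^k(x) + a`**), `mem_blockErase_add_iff`.
* `holTo_translate` — the concrete contour variables (0.11) transform by (2.17): `(τ_{La}U)(y, x) = U(y + a, x + La)`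
  for ALL `U` (both branches of the total map transport letter by letter).
* **`gaugeFixFn_translate`** — `G(τ_{La}U) = G(U)`: the gauge-fixing term of (2.1) is invariant under the coarse
  translations of (2.17), unconditionally.
* Permutations: `offsetOf_permute`, `blockOf_permute`, `mem_blockErase_permute_iff`, `holTo_permute_of_adm`, and
  **`gaugeFixFn_permute_of_adm`** — `G(πU) = G(U)` for every coordinate permutation `π`, for configurations `U` all
  of whose staircase families are admissible for the group average `M` (the small-field domain where (0.11) is the
  printed `M`-average; off it the tree's total map `contourData` uses a single-staircase fallback which is not
  `S_d`-symmetric — `BlockAveragingTwoLevel` DIVERGENCE (b)).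
* Centre reflections `x_ρ ↦ −x_ρ − 1` (`T4Covariance.GaugeField.creflect`, the block-compatible reflections of the
  nested tori — `Site.emb_creflect`, `AveragingReflection`'s `blockOf_creflect_eq_iff`): `creflectSite_creflectSite`
  (involution), `siteCreflectEquiv`, `offsetOf_creflect_of_lt` /
  `offsetOf_creflect_of_blockOf` (the `ρ`-th offset from the block centre is negated, off the antipode / on `B(y)`),
  `mem_blockErase_creflect_iff`, `holTo_creflect_of_blockOf` (`(c_ρU)(y, x) = U(c_ρ y, c_ρ x)` for `x ∈ B(y)`, all
  `U`), and **`gaugeFixFn_creflect`** — `G(c_ρU) = G(U)`, unconditionally (v1.1).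
NOT typed here: the invariance of the other factors of (2.1) (`A`, `E_k`, `χ_k`, the δ-functions), which are the
tree's `wilsonAction_translate/permute` and obligations on the abstract step data.  Nothing of the series is asserted;
axioms standard.

v1.1 (this version): + section 4 (centre reflections); sections 1–3 unchanged from v1 (p242599).
-/

namespace Literature.MathematicalPhysics.QuantumFieldTheory.Balaban1983to89.B12GaugeFixInvariance269

open Literature.MathematicalPhysics.QuantumFieldTheory.Balaban1983to89
open BlockAveragingTwoLevel T4Continuum

noncomputable section

variable {P : Params} {j : ℕ}

/-! ## 1. Coarse translations on the nested tori -/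

/-- The offset `x − emb y` from the block centre is invariant under a coarse translation `a` acting by `L·a` on the fine
lattice (`emb (y + a) = emb y + L·a`). [cite: Balaban1987RG1, (2.17) p.269] -/
theorem offsetOf_add_scale (y a : Site P (j+1)) (x : Site P j) :
    offsetOf (y + a) (x + Site.scale a) = offsetOf y x := by
  funext ν
  simp only [offsetOf, Site.emb_add]
  congr 1
  show x ν + Site.scale a ν - (emb y ν + Site.scale a ν) = x ν - emb y ν
  ring

/-- The points `nL + r` of the block `B(y)` in coordinates: `blockSite y r = L·y + r`. [cite: Balaban1987RG1, (0.3) p.252] -/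
theorem blockSite_apply_eq (y : Site P (j+1)) (r : Fin P.d → Fin P.L) (μ : Fin P.d) :
    Site.blockSite y r μ = Site.scaleCoord P j (y μ) + ((r μ : ℕ) : ZMod (P.sitesPerDir j)) := by
  show (((y μ).val * P.L + r μ : ℕ) : ZMod (P.sitesPerDir j)) = _
  rw [Nat.cast_add, Site.scaleCoord_apply]

/-- `blockSite (y + a) r = blockSite y r + L·a`: a coarse translation carries the points of `B(y)` to the corresponding
points of `B(y + a)`. [cite: Balaban1987RG1, (0.3) p.252] -/
theorem blockSite_add (y a : Site P (j+1)) (r : Fin P.d → Fin P.L) :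
    Site.blockSite (y + a) r = Site.blockSite y r + Site.scale a := by
  funext μ
  show Site.blockSite (y + a) r μ = Site.blockSite y r μ + Site.scale a μ
  rw [blockSite_apply_eq, blockSite_apply_eq, Site.scale_apply,
    show (y + a) μ = y μ + a μ from rfl, map_add]
  ring

/-- **Blocks go to blocks**: `B^k`-membership is compatible with the coarse translations — `blockOf (x + L·a) =
blockOf x + a` (standing range `j + 1 ≤ m + K`).  This is the «preserving the torus T^{(k+1)}» clause of (2.17) for
translations, in the tree's centred block geometry (0.3). [cite: Balaban1987RG1, (2.17) p.269] -/
theorem blockOf_add_scale (hj : j + 1 ≤ P.m + P.K) (x : Site P j) (a : Site P (j+1)) :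
    blockOf (x + Site.scale a) = blockOf x + a := by
  obtain ⟨r, hr⟩ : ∃ r : Fin P.d → Fin P.L, Site.blockSite (blockOf x) r = x :=
    ⟨Site.blockEquiv hj (blockOf x) ⟨x, rfl⟩,
      congrArg Subtype.val ((Site.blockEquiv hj (blockOf x)).left_inv ⟨x, rfl⟩)⟩
  conv_lhs => rw [← hr]
  rw [← blockSite_add, Site.blockOf_blockSite hj]

/-- The index set `{x ∈ B(y), x ≠ y}` of the gauge-fixing term is carried onto `{x ∈ B(y + a), x ≠ y + a}` by
`x ↦ x + L·a`. [cite: Balaban1987RG1, (0.17) p.255] -/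
theorem mem_blockErase_add_iff (hj : j + 1 ≤ P.m + P.K) (y a : Site P (j+1)) (x : Site P j) :
    x + Site.scale a ∈ (block (y + a)).erase (emb (y + a)) ↔ x ∈ (block y).erase (emb y) := by
  simp only [Finset.mem_erase, block, Finset.mem_filter, Finset.mem_univ, true_and, Site.emb_add,
    blockOf_add_scale hj, ne_eq, add_left_inj]

/-! ## 2. The concrete contour variables and the gauge-fixing term under coarse translations -/

section Translate

variable {G : Type*} [GaugeGroup G] (𝓜 : GroupAverage G)

/-- **(2.17) on the averaged contour variables (0.11)**: `(τ_{La}U)(y, x) = U(y + a, x + La)` for the tree's total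
map `BlockAveragingTwoLevel.contourData 𝓜` and EVERY configuration `U` (the admissibility guard, the average and the
single-staircase fallback all transport letter by letter: `stairHol_translate`, `cVar_translate`).
[cite: Balaban1987RG1, (2.17) p.269] -/
theorem holTo_translate (y a : Site P (j+1)) (U : GaugeField P j G) (x : Site P j) :
    holTo 𝓜 (U.translate (Site.scale a)) y x = holTo 𝓜 U (y + a) (x + Site.scale a) := by
  have hs : stairHol (U.translate (Site.scale a)) y (offsetOf y x) = stairHol U (y + a) (offsetOf y x) :=
    funext (stairHol_translate a U y (offsetOf y x))
  unfold holTo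
  rw [offsetOf_add_scale, hs, cVar_translate]

/-- **`G(τ_{La}V) = G(V)`** — the gauge-fixing term `Σ_{y∈T^{(k+1)}} Σ_{x∈B(y), x≠y} [1 − Re tr V(y,x)]` of (2.1)
(tree `Setup.gaugeFixFn` over the concrete (0.11) data) is invariant under the coarse translations of (2.17): p. 269
«By their definitions the expressions in (2.1) are invariant with respect to these transformations», for this factor,
PROVED (translate the variables by `holTo_translate`, re-index the inner sum by `x ↦ x + La` and the outer by
`y ↦ y + a`). [cite: Balaban1987RG1, (2.17) p.269] -/
theorem gaugeFixFn_translate (hj : j + 1 ≤ P.m + P.K) (a : Site P (j+1)) (U : GaugeField P j G) :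
    gaugeFixFn (contourData 𝓜) Finset.univ (U.translate (Site.scale a))
      = gaugeFixFn (contourData 𝓜) Finset.univ U := by
  unfold gaugeFixFn
  show ∑ y, ∑ x ∈ (block y).erase (emb y), (1 - reTr (holTo 𝓜 (U.translate (Site.scale a)) y x))
    = ∑ y, ∑ x ∈ (block y).erase (emb y), (1 - reTr (holTo 𝓜 U y x))
  simp_rw [holTo_translate 𝓜]
  have hinner : ∀ y : Site P (j+1),
      ∑ x ∈ (block y).erase (emb y), (1 - reTr (holTo 𝓜 U (y + a) (x + Site.scale a)))
        = ∑ x ∈ (block (y + a)).erase (emb (y + a)), (1 - reTr (holTo 𝓜 U (y + a) x)) := by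
    intro y
    exact Finset.sum_equiv (Equiv.addRight (Site.scale a)) (fun x => (mem_blockErase_add_iff hj y a x).symm)
      (fun x _ => rfl)
  simp_rw [hinner]
  exact Fintype.sum_equiv (Equiv.addRight a) _ _ (fun y => rfl)

end Translate

/-! ## 3. Coordinate permutations (on the small-field domain) -/

/-- Offsets transform by `π`: `offsetOf (πy) (πx) = (offsetOf y x) ∘ π⁻¹` (`emb` commutes with `π`).
[cite: Balaban1987RG1, (2.17) p.269] -/
theorem offsetOf_permute (π : Equiv.Perm (Fin P.d)) (y : Site P (j+1)) (x : Site P j) :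
    offsetOf (y.permute π) (x.permute π) = offsetOf y x ∘ π.symm := by
  funext ν
  simp only [offsetOf, Function.comp_apply]
  rw [T4Continuum.emb_permute]
  rfl

/-- Blocks go to blocks under coordinate permutations: `blockOf (πx) = π(blockOf x)`. [cite: Balaban1987RG1, (2.17) p.269] -/
theorem blockOf_permute (π : Equiv.Perm (Fin P.d)) (x : Site P j) :
    blockOf (x.permute π) = (blockOf x).permute π := rfl

/-- `Site.permute π` as a bijection of the sites (inverse `Site.permute π⁻¹`). [cite: Balaban1987RG1, (2.17) p.269] -/
def sitePermuteEquiv (π : Equiv.Perm (Fin P.d)) : Site P j ≃ Site P j where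
  toFun x := x.permute π
  invFun x := x.permute π⁻¹
  left_inv x := by
    show (x.permute π).permute π⁻¹ = x
    rw [← Site.permute_mul, inv_mul_cancel, Site.permute_one]
  right_inv x := by
    show (x.permute π⁻¹).permute π = x
    rw [← Site.permute_mul, mul_inv_cancel, Site.permute_one]

/-- `Site.permute π` is injective. [cite: Balaban1987RG1, (2.17) p.269] -/
theorem permute_inj (π : Equiv.Perm (Fin P.d)) {x x' : Site P j} : x.permute π = x'.permute π ↔ x = x' := by
  constructor
  · intro h
    have h' := congrArg (Site.permute π⁻¹) h
    rwa [← Site.permute_mul, ← Site.permute_mul, inv_mul_cancel, Site.permute_one, Site.permute_one] at h'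
  · intro h; rw [h]

/-- The index set `{x ∈ B(y), x ≠ y}` is carried onto `{x ∈ B(πy), x ≠ πy}` by `x ↦ πx`. [cite: Balaban1987RG1, (0.17) p.255] -/
theorem mem_blockErase_permute_iff (π : Equiv.Perm (Fin P.d)) (y : Site P (j+1)) (x : Site P j) :
    x.permute π ∈ (block (y.permute π)).erase (emb (y.permute π)) ↔ x ∈ (block y).erase (emb y) := by
  simp only [Finset.mem_erase, block, Finset.mem_filter, Finset.mem_univ, true_and, T4Continuum.emb_permute,
    blockOf_permute, ne_eq]
  rw [permute_inj, permute_inj]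

section Permute

variable {G : Type*} [GaugeGroup G] (𝓜 : GroupAverage G)

/-- **(2.17) on the averaged contour variables (0.11), permutations**: `(πU)(y, x) = U(πy, πx)` whenever the
staircase family of `U` at `(πy, πx)` is admissible for `M` (there the value is the printed average, which is
permutation-symmetric by (0.7): `cVar_permute`). [cite: Balaban1987RG1, (2.17) p.269] -/
theorem holTo_permute_of_adm (π : Equiv.Perm (Fin P.d)) (U : GaugeField P j G) (y : Site P (j+1)) (x : Site P j)
    (h : 𝓜.Adm (stairHol U (y.permute π) (offsetOf (y.permute π) (x.permute π)))) :
    holTo 𝓜 (U.permute π) y x = holTo 𝓜 U (y.permute π) (x.permute π) := by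
  have h' : 𝓜.Adm (stairHol U (y.permute π) (offsetOf y x ∘ π.symm)) := by rwa [offsetOf_permute] at h
  unfold holTo
  rw [offsetOf_permute, if_pos ((adm_permute_iff 𝓜 π U y _).2 h'), if_pos h', cVar_permute 𝓜 π U y _ h']

/-- **`G(πV) = G(V)` on the small-field domain** — the gauge-fixing term of (2.1) is invariant under the coordinate
permutations of (2.17) for every configuration all of whose staircase families `G(y,x)`, `x ∈ B(y)`, `x ≠ y`, are
admissible for the group average `M` (the domain on which (0.11) is the printed average).  PROVED (re-index by
`x ↦ πx`, `y ↦ πy`). [cite: Balaban1987RG1, (2.17) p.269] -/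
theorem gaugeFixFn_permute_of_adm (π : Equiv.Perm (Fin P.d)) (U : GaugeField P j G)
    (hadm : ∀ (y : Site P (j+1)) (x : Site P j), x ∈ (block y).erase (emb y) →
      𝓜.Adm (stairHol U y (offsetOf y x))) :
    gaugeFixFn (contourData 𝓜) Finset.univ (U.permute π) = gaugeFixFn (contourData 𝓜) Finset.univ U := by
  unfold gaugeFixFn
  show ∑ y, ∑ x ∈ (block y).erase (emb y), (1 - reTr (holTo 𝓜 (U.permute π) y x))
    = ∑ y, ∑ x ∈ (block y).erase (emb y), (1 - reTr (holTo 𝓜 U y x))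
  have hinner : ∀ y : Site P (j+1),
      ∑ x ∈ (block y).erase (emb y), (1 - reTr (holTo 𝓜 (U.permute π) y x))
        = ∑ x ∈ (block (y.permute π)).erase (emb (y.permute π)), (1 - reTr (holTo 𝓜 U (y.permute π) x)) := by
    intro y
    refine Finset.sum_equiv (sitePermuteEquiv π) (fun x => (mem_blockErase_permute_iff π y x).symm) ?_
    intro x hx
    have hx' : x.permute π ∈ (block (y.permute π)).erase (emb (y.permute π)) :=
      (mem_blockErase_permute_iff π y x).2 hx
    show 1 - reTr (holTo 𝓜 (U.permute π) y x) = 1 - reTr (holTo 𝓜 U (y.permute π) (x.permute π))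
    rw [holTo_permute_of_adm 𝓜 π U y x (hadm _ _ hx')]
  simp_rw [hinner]
  exact Fintype.sum_equiv (sitePermuteEquiv π) _ _ (fun y => rfl)

end Permute

/-! ## 4. Centred reflections -/

/-- The centre reflection `x_ρ ↦ −x_ρ − 1` of the labels (the site map underlying `GaugeField.creflect ρ`) is an
involution. [cite: Balaban1987RG1, (2.17) p.269] -/
theorem creflectSite_creflectSite (ρ : Fin P.d) (x : Site P j) :
    ((((x.reflect ρ).unshift ρ).reflect ρ).unshift ρ) = x := by
  funext ν
  simp only [Site.unshift_apply, Site.reflect_apply]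
  by_cases h : ν = ρ
  · subst h; simp only [if_true]; ring
  · simp only [if_neg h]

/-- The centre reflection as a bijection of the sites (its own inverse). [cite: Balaban1987RG1, (2.17) p.269] -/
def siteCreflectEquiv (ρ : Fin P.d) : Site P j ≃ Site P j where
  toFun x := (x.reflect ρ).unshift ρ
  invFun x := (x.reflect ρ).unshift ρ
  left_inv x := creflectSite_creflectSite ρ x
  right_inv x := creflectSite_creflectSite ρ x

/-- The centre reflection is injective on sites. [cite: Balaban1987RG1, (2.17) p.269] -/
theorem creflectSite_inj (ρ : Fin P.d) {x x' : Site P j} :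
    (x.reflect ρ).unshift ρ = (x'.reflect ρ).unshift ρ ↔ x = x' :=
  (siteCreflectEquiv ρ).injective.eq_iff

/-- In `ZMod n`, negation commutes with the centred residue away from the antipode: if `2·|a| < n` (centred residue
`a`), then `valMinAbs (−a) = −valMinAbs a` (private helper). [folklore] -/
private theorem valMinAbs_neg_of_two_mul_natAbs_lt {n : ℕ} (a : ZMod n) (h : 2 * a.valMinAbs.natAbs < n) :
    (-a).valMinAbs = -a.valMinAbs := by
  apply ZMod.valMinAbs_neg_of_ne_half
  intro h2
  have h3 : a.valMinAbs * 2 = n := (ZMod.valMinAbs_mul_two_eq_iff a).2 h2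
  have h4 : (2 * a.valMinAbs.natAbs : ℤ) = n := by
    rw [Int.natCast_natAbs, abs_of_nonneg (by omega)]
    omega
  omega

/-- Offsets from the block centre transform under the centre reflection by `negAt ρ` (the `ρ`-th offset is negated),
for every fine site `x` off the `ρ`-antipode of the centre `emb y` (`2·|x_ρ − (emb y)_ρ| < N_j` in centred residues;
`emb (c_ρ y) = c_ρ (emb y)` by `Site.emb_creflect`). [cite: Balaban1987RG1, (2.17) p.269] -/
theorem offsetOf_creflect_of_lt (ρ : Fin P.d) (y : Site P (j+1)) (x : Site P j)
    (h : 2 * ((x ρ - emb y ρ).valMinAbs).natAbs < P.sitesPerDir j) :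
    offsetOf ((y.reflect ρ).unshift ρ) ((x.reflect ρ).unshift ρ) = negAt ρ (offsetOf y x) := by
  funext ν
  rw [offsetOf, Site.emb_creflect]
  by_cases hν : ν = ρ
  · subst hν
    rw [negAt_self, offsetOf, Site.unshift_apply, if_pos rfl, Site.reflect_apply, if_pos rfl, Site.unshift_apply,
      if_pos rfl, Site.reflect_apply, if_pos rfl, ← valMinAbs_neg_of_two_mul_natAbs_lt _ h]
    congr 1
    ring
  · rw [negAt_of_ne _ _ hν, offsetOf, Site.unshift_apply, if_neg hν, Site.reflect_apply, if_neg hν,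
      Site.unshift_apply, if_neg hν, Site.reflect_apply, if_neg hν]

/-- On the points of the block `B(y)` the antipode condition holds (there `|x_ρ − (emb y)_ρ| ≤ (L−1)/2 < N_j/2`,
standing range), so **`offsetOf (c_ρ y) (c_ρ x) = negAt ρ (offsetOf y x)` for `x ∈ B(y)`**. [cite: Balaban1987RG1, (2.17) p.269] -/
theorem offsetOf_creflect_of_blockOf (hj : j + 1 ≤ P.m + P.K) (ρ : Fin P.d) (y : Site P (j+1)) (x : Site P j)
    (hx : blockOf x = y) :
    offsetOf ((y.reflect ρ).unshift ρ) ((x.reflect ρ).unshift ρ) = negAt ρ (offsetOf y x) := by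
  apply offsetOf_creflect_of_lt
  obtain ⟨r, hr⟩ : ∃ r : Fin P.d → Fin P.L, Site.blockSite y r = x :=
    ⟨Site.blockEquiv hj y ⟨x, hx⟩, congrArg Subtype.val ((Site.blockEquiv hj y).left_inv ⟨x, hx⟩)⟩
  have h1 : (x ρ - emb y ρ).valMinAbs = BlockAveraging.off r ρ := by
    rw [← hr]; exact congrFun (offsetOf_blockSite hj y r) ρ
  rw [h1]
  have hb := BlockAveraging.off_bounds r ρ
  have hL := AveragingRT.two_mul_half_add_one P
  have hN : P.L ≤ P.sitesPerDir j := by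
    rw [P.sitesPerDir_eq_mul_succ hj]
    exact Nat.le_mul_of_pos_left P.L (Nat.pos_of_ne_zero (P.sitesPerDir_ne_zero (j+1)))
  omega

/-- Blocks go to blocks under the centre reflections (`AveragingReflection`'s `blockOf_creflect_eq_iff`) and block
centres to block centres (`Site.emb_creflect`): the index set `{x ∈ B(y), x ≠ y}` is carried onto
`{x ∈ B(c_ρ y), x ≠ c_ρ y}` by `x ↦ c_ρ x`. [cite: Balaban1987RG1, (0.17) p.255] -/
theorem mem_blockErase_creflect_iff (hj : j + 1 ≤ P.m + P.K) (ρ : Fin P.d) (y : Site P (j+1)) (x : Site P j) :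
    (x.reflect ρ).unshift ρ ∈ (block ((y.reflect ρ).unshift ρ)).erase (emb ((y.reflect ρ).unshift ρ))
      ↔ x ∈ (block y).erase (emb y) := by
  simp only [Finset.mem_erase, block, Finset.mem_filter, Finset.mem_univ, true_and, Site.emb_creflect,
    blockOf_creflect_eq_iff hj, ne_eq, creflectSite_inj]

section Creflect

variable {G : Type*} [GaugeGroup G] (𝓜 : GroupAverage G)

/-- **(2.17) on the averaged contour variables (0.11), centre reflections**: `(c_ρU)(y, x) = U(c_ρ y, c_ρ x)` for
EVERY configuration `U` and every `x ∈ B(y)` (both branches of the total map transport letter by letter: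
`stairHol_creflect`, `cVar_creflect`; the offset by `offsetOf_creflect_of_blockOf`). [cite: Balaban1987RG1, (2.17) p.269] -/
theorem holTo_creflect_of_blockOf (hj : j + 1 ≤ P.m + P.K) (ρ : Fin P.d) (U : GaugeField P j G)
    (y : Site P (j+1)) (x : Site P j) (hx : blockOf x = y) :
    holTo 𝓜 (U.creflect ρ) y x = holTo 𝓜 U ((y.reflect ρ).unshift ρ) ((x.reflect ρ).unshift ρ) := by
  have hs : stairHol (U.creflect ρ) y (offsetOf y x)
      = stairHol U ((y.reflect ρ).unshift ρ) (negAt ρ (offsetOf y x)) :=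
    funext (stairHol_creflect ρ U y (offsetOf y x))
  unfold holTo
  rw [offsetOf_creflect_of_blockOf hj ρ y x hx, hs, cVar_creflect]

/-- **`G(c_ρV) = G(V)`** — the gauge-fixing term of (2.1) is invariant under the centre reflections of (2.17)
(the block-compatible reflections of the nested tori, `T4Covariance.GaugeField.creflect`), unconditionally.  PROVED
(transport the variables by `holTo_creflect_of_blockOf`, re-index the inner sum by `x ↦ c_ρ x` and the outer by
`y ↦ c_ρ y`).  With `gaugeFixFn_translate` and `gaugeFixFn_permute_of_adm` this covers generators of the group of
Euclidean symmetries of `T` preserving `T^{(k+1)}` of p. 269. [cite: Balaban1987RG1, (2.17) p.269] -/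
theorem gaugeFixFn_creflect (hj : j + 1 ≤ P.m + P.K) (ρ : Fin P.d) (U : GaugeField P j G) :
    gaugeFixFn (contourData 𝓜) Finset.univ (U.creflect ρ) = gaugeFixFn (contourData 𝓜) Finset.univ U := by
  unfold gaugeFixFn
  show ∑ y, ∑ x ∈ (block y).erase (emb y), (1 - reTr (holTo 𝓜 (U.creflect ρ) y x))
    = ∑ y, ∑ x ∈ (block y).erase (emb y), (1 - reTr (holTo 𝓜 U y x))
  have hinner : ∀ y : Site P (j+1),
      ∑ x ∈ (block y).erase (emb y), (1 - reTr (holTo 𝓜 (U.creflect ρ) y x))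
        = ∑ x ∈ (block ((y.reflect ρ).unshift ρ)).erase (emb ((y.reflect ρ).unshift ρ)),
            (1 - reTr (holTo 𝓜 U ((y.reflect ρ).unshift ρ) x)) := by
    intro y
    refine Finset.sum_equiv (siteCreflectEquiv ρ) (fun x => (mem_blockErase_creflect_iff hj ρ y x).symm) ?_
    intro x hx
    have hx' : blockOf x = y := by
      have := (Finset.mem_erase.1 hx).2
      simpa only [block, Finset.mem_filter, Finset.mem_univ, true_and] using this
    show 1 - reTr (holTo 𝓜 (U.creflect ρ) y x)
      = 1 - reTr (holTo 𝓜 U ((y.reflect ρ).unshift ρ) ((x.reflect ρ).unshift ρ))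
    rw [holTo_creflect_of_blockOf 𝓜 hj ρ U y x hx']
  simp_rw [hinner]
  exact Fintype.sum_equiv (siteCreflectEquiv ρ) _ _ (fun y => rfl)

end Creflect

end

end Literature.MathematicalPhysics.QuantumFieldTheory.Balaban1983to89.B12GaugeFixInvariance269
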